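import Literature.NumberTheory.GaloisCohomology.Howard2004.DVRSettingFrobeniusCharacterProofs
import Literature.NumberTheory.GaloisCohomology.Howard2004.ResidualDualityDatumProofs
import Literature.NumberTheory.GaloisCohomology.Howard2004.LocalTwoDetectsFiniteProofs
import Literature.NumberTheory.GaloisRepresentations.ContinuousH2OrderTwo
import HarnessLib

/-!
# Howard 2004, H.4 / §2.1 for the RESIDUAL representation `T̄ = T/𝔪T` over a level ring `R_k`:
# `Θ̄ : Tw(T̄) ⥲ Hom(T̄, μ_{p^{k'}})` is bijective although `T̄` is NOT free over `R_k` (proofs file, RES-READ)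

Topic `NumberTheory/GaloisCohomology/Howard2004` (sequel to `DVRSettingFrobeniusCharacterProofs` — the Frobenius character
`λ` of every level ring `R_k = R/𝔪^{e_k}` and `Θ` bijective for FREE level modules — and to `ResidualDualityDatumProofs`
— the residual duality datum `D̄` on `T̄`).  THEOREMS ONLY: no definition, no named fact, no instance, no notation, no `sorry`.

B. Howard, *The Heegner point Kolyvagin system*, Compositio Math. **140** (2004) = arXiv:1202.6340, §1.3 H.4 (p. 7 L69–82)
and §2.1 (p. 13 L20–24: «`Hom_{S_𝔭}(N, 𝒟_𝔭(1)) ≅ Hom_{ℤ_p}(N, μ_{p^∞})`»); Lemma 1.5.3 / Lemma 1.6.4 read the local and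
global dualities ON `T̄` (Def. 1.5.2: `H¹_{F(n)}(K, T̄)^±`, p. 9 L133–138).  The cell's reading of local Tate duality
through the H.4 datum is `DualityDatum.toTateDual λ exp : Tw(T) → Hom(T, μ_{p^{k'}})`, bijective under the DUALIZING
property `hlamb : Bijective (φ ↦ λ ∘ φ : Hom_R(T, R) → Hom_ℤ(T, ℤ/p^{k'}))` (`toTateDual_bijective`); the tree derives
`hlamb` for FREE modules (`bijective_comp_linearMap_of_free`).  `T̄` is killed by `𝔪_{R_k}`, hence not free over `R_k`
unless `e_k = 1`.  Here `hlamb` is proved for any module PRESENTED as a quotient of a free one — in particular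
`T̄ = T^{(k)}/𝔪T^{(k)}` (H.1) — and `Θ̄` is bijective for EVERY duality datum on `T̄` over `R_k` (e.g. the residual datum
of `exists_residualDualityDatum`):

* §1 (generic) **`bijective_comp_linearMap_of_surjective`** — `R` a commutative ring with a Frobenius character `λ`
  (`r ↦ λ(r·)` bijective), `π̄ : M ↠ N̄` `R`-linear onto with `M` finite free: `φ ↦ λ ∘ φ : Hom_R(N̄, R) → Hom_ℤ(N̄, ℤ/n)`
  is bijective (injective as in the free case; a preimage of `χ` is the factorisation through `π̄` of the preimage `Φ`
  of `χ ∘ π̄` — `Φ` kills `ker π̄` because `λ(Φ(m)·) = χ(π̄(· m)) = 0` and `λ` is Frobenius).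
* §2 on a `DVRSetting` with H.0–H.5: `finite_residual` (`T̄` is finite), **`exists_residual_toTateDual_bijective`** —
  for `p^{k'} ∈ 𝔪^{e_k}`, a bijective trivialisation `exp` of `μ_{p^{k'}}` and ANY `D̄ : DualityDatum p cd ρ̄ R_k`:
  `∃ λ hλ, Bijective (λ(r·))_r ∧ Bijective (D̄.toTateDual λ hλ exp hexp)`; **`residual_hdet`** — the `H²`-detection
  binder of the Frobenius-form reading files («`(∀ b, H²(exp ∘ λ_b) z = 0) → z = 0`» at EVERY place, finite places by
  `eq_zero_of_forall_cohomologyMap_expLam_eq_zero_of_finite`, infinite places by odd torsion).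

Cell `pub/bsd-print-x9`, G87 = Howard Thm. 1.6.1 (print leaf `stub_h161` of stmt-BirchSwinnertonDyer-22642); seat
`bsd-line-x10b-p1-w8` g11, brick (GD-LINE-S) part R1 (RES-READ).  HONEST FRAMING: `thm161_dvrKolyvaginBound` is NOT
proved; no summit statement is proved; the Birch–Swinnerton-Dyer conjecture is not proved by any of this.

References: [Howard2004HeegnerKolyvagin] §1.3 H.4, §2.1, Def. 1.5.2; [Wood1999DualityCodesFiniteRings] Thm. 3.10;
[MilneADT2006] I §2, I Cor. 2.3; [SerreGaloisCohomology1997] II §5.2.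
-/

set_option autoImplicit false

noncomputable section

open Function NumberField IsDedekindDomain Field
open scoped NumberField ContRepresentation

namespace Literature.NumberTheory.GaloisCohomology.Howard2004

open Literature.NumberTheory.GaloisRepresentations
open Literature.NumberTheory.GaloisRepresentations.DiscreteGaloisModule
open Literature.RingTheory.CompleteLocalRings

/-! ## §1 The dualizing property for a quotient of a free module -/

/-- **`Hom_R(N̄, R) ≅ Hom_ℤ(N̄, ℤ/n)` under `φ ↦ λ ∘ φ` for a module `N̄` presented as a quotient `π̄ : M ↠ N̄` of a finite
free `R`-module `M`**, `λ` a Frobenius character of `R` (`r ↦ λ(r ·)` bijective).  Injective: `λ(φ(x̄)·s) = λ(φ(s x̄))`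
determines `λ(φ(x̄)·)`, hence `φ(x̄)`.  Surjective: for `χ : N̄ → ℤ/n` let `Φ : M →ₗ R` with `λ ∘ Φ = χ ∘ π̄` (free case);
for `m ∈ ker π̄`, `λ(Φ(m) s) = χ(π̄(s m)) = 0` for all `s`, so `Φ(m) = 0`; `Φ` factors through `π̄` as the wanted `φ`.
(Howard §2.1 «`Hom_{S_𝔭}(N, 𝒟_𝔭(1)) ≅ Hom_{ℤ_p}(N, μ_{p^∞})`» for the non-free `N = T̄`.)
[cite: Howard2004HeegnerKolyvagin, §2.1 (arXiv:1202.6340 p. 13 L20–24)] [cite: Wood1999DualityCodesFiniteRings, Thm. 3.10] -/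
theorem bijective_comp_linearMap_of_surjective {R : Type*} [CommRing R] {M Nb : Type*} [AddCommGroup M] [Module R M]
    [Module.Free R M] [Module.Finite R M] [AddCommGroup Nb] [Module R Nb] {n : ℕ} (lam : R →+ ZMod n)
    (hlam : Bijective ((AddMonoidHom.mul : R →+ R →+ R).compr₂ lam)) (πbar : M →ₗ[R] Nb)
    (hπ : Function.Surjective πbar) :
    Bijective fun φ : Nb →ₗ[R] R => lam.comp φ.toAddMonoidHom := by
  have hb_apply : ∀ r s : R, (AddMonoidHom.mul : R →+ R →+ R).compr₂ lam r s = lam (r * s) := fun r s => rfl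
  constructor
  · -- injective (as in the free case)
    intro φ ψ hφψ
    have h : ∀ x, lam (φ x) = lam (ψ x) := fun x => congrArg (fun f : Nb →+ ZMod n => f x) hφψ
    refine LinearMap.ext fun x => ?_
    apply hlam.1
    refine AddMonoidHom.ext fun r => ?_
    rw [hb_apply, hb_apply, mul_comm (φ x), mul_comm (ψ x), ← smul_eq_mul, ← smul_eq_mul, ← map_smul,
      ← map_smul]
    exact h (r • x)
  · -- surjective: lift `χ ∘ π̄` to `Φ : M →ₗ R`, which kills `ker π̄`
    intro χ
    obtain ⟨Φ, hΦ⟩ := (bijective_comp_linearMap_of_free (M := M) lam hlam).2 (χ.comp πbar.toAddMonoidHom)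
    have hΦ' : ∀ m : M, lam (Φ m) = χ (πbar m) := fun m =>
      congrArg (fun f : M →+ ZMod n => f m) hΦ
    have hker : LinearMap.ker πbar ≤ LinearMap.ker Φ := by
      intro m hm
      rw [LinearMap.mem_ker] at hm ⊢
      apply hlam.1
      refine AddMonoidHom.ext fun s => ?_
      rw [hb_apply, hb_apply, zero_mul, map_zero, mul_comm, ← smul_eq_mul, ← map_smul, hΦ', map_smul, hm,
        smul_zero, map_zero]
    refine ⟨((LinearMap.ker πbar).liftQ Φ hker).comp (πbar.quotKerEquivOfSurjective hπ).symm.toLinearMap,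
      AddMonoidHom.ext fun x => ?_⟩
    obtain ⟨m, rfl⟩ := hπ x
    change lam (((LinearMap.ker πbar).liftQ Φ hker) ((πbar.quotKerEquivOfSurjective hπ).symm (πbar m))) = χ (πbar m)
    rw [LinearMap.quotKerEquivOfSurjective_symm_apply, Submodule.liftQ_apply, hΦ']

/-! ## §2 On a `DVRSetting`: `Θ̄` bijective for every duality datum on `T̄` over `R_k` -/

namespace DVRSetting

variable {p : ℕ} [Fact p.Prime] {K : Type} [Field K] [NumberField K]
  {R : Type} [CommRing R] [IsDomain R] [IsDiscreteValuationRing R] [Algebra ℤ_[p] R]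
  {N : ℕ → Type} [∀ k, AddCommGroup (N k)] [∀ k, TopologicalSpace (N k)]
  [∀ k, DiscreteTopology (N k)] [∀ k, Module R (N k)]
  {Rk : ℕ → Type} [∀ k, CommRing (Rk k)] [∀ k, IsLocalRing (Rk k)] [∀ k, TopologicalSpace (Rk k)]
  [∀ k, DiscreteTopology (Rk k)] [∀ k, Algebra ℤ_[p] (Rk k)] [∀ k, Algebra R (Rk k)]
  [∀ k, Module (Rk k) (N k)] [∀ k, IsScalarTower R (Rk k) (N k)]
  {Nbar : Type} [AddCommGroup Nbar] [TopologicalSpace Nbar] [DiscreteTopology Nbar]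
  [∀ k, Module (Rk k) Nbar]
  {Nq : ℕ → Finset (HeightOneSpectrum (𝓞 K)) → Type} [∀ k n, AddCommGroup (Nq k n)]
  [∀ k n, TopologicalSpace (Nq k n)] [∀ k n, DiscreteTopology (Nq k n)]
  [∀ k n, Module (Rk k) (Nq k n)] [∀ k n, Module R (Nq k n)]
  [∀ k n, IsScalarTower R (Rk k) (Nq k n)]

/-- **`T̄` is finite** on a `DVRSetting` with H.0–H.5 (a quotient of the finite level `T^{(k)}` by H.1).
[cite: Howard2004HeegnerKolyvagin, §1.3 H.1 (arXiv:1202.6340 p. 7 L59)] -/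
theorem finite_residual (S : DVRSetting p K R N Rk Nbar Nq) (hy : S.SatisfiesH) : Finite Nbar := by
  haveI : Finite (N 0) := S.finite_level hy 0
  exact Finite.of_surjective _ (hy.h1 0).1.surjective

/-- **`Θ̄ : Tw(T̄) ⥲ Hom(T̄, μ_{p^{k'}})` is bijective for EVERY duality datum `D̄` on the residual representation `T̄`
over the level ring `R_k`** (H.0–H.5; `p^{k'} ∈ 𝔪^{e_k}`; `exp` a bijective equivariant trivialisation of `μ_{p^{k'}}`):
there is a Frobenius character `λ : R_k → ℤ/p^{k'}` (`r ↦ λ(r·)` bijective, automatically `ℤ_p`-semilinear) with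
`D̄.toTateDual λ hλ exp hexp` bijective — the binders `lam, hlam, hfrob, hΘ` of the Frobenius-form reading files
(`…_frob`) at the RESIDUAL level, where `T̄` is not free over `R_k` (`hlamb` by `bijective_comp_linearMap_of_surjective`
through H.1's presentation `π̄_k : T^{(k)} ↠ T̄`).
[cite: Howard2004HeegnerKolyvagin, §1.3 H.4 and §2.1 (arXiv:1202.6340 p. 7 L69–82, p. 13 L20–24)] [cite: Wood1999DualityCodesFiniteRings, Thm. 3.10] -/
theorem exists_residual_toTateDual_bijective [Finite Nbar] (S : DVRSetting p K R N Rk Nbar Nq) (hy : S.SatisfiesH)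
    (k : ℕ) {k' : ℕ} (hk' : ((p : ℕ) : R) ^ k' ∈ IsLocalRing.maximalIdeal R ^ S.e k)
    (exp : ZMod (p ^ k') →+ MuCarrier K (p ^ k'))
    (hexp : ∀ (g : absoluteGaloisGroup K) (x : ZMod (p ^ k')),
      exp (cyclotomicCharacterModPow K p k' g * x) = mu K (p ^ k') g (exp x))
    (hexpb : Bijective exp) (Dbar : DualityDatum p S.cd S.ρbar (Rk k)) :
    ∃ (lam : Rk k →+ ZMod (p ^ k'))
      (hlam : ∀ (z : ℤ_[p]) (a : Rk k), lam (algebraMap ℤ_[p] (Rk k) z * a) = PadicInt.toZModPow k' z * lam a),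
      Bijective ((AddMonoidHom.mul : Rk k →+ Rk k →+ Rk k).compr₂ lam) ∧
        Bijective (Dbar.toTateDual lam hlam exp hexp) := by
  haveI : NeZero (p ^ k') := ⟨pow_ne_zero _ (Fact.out : p.Prime).ne_zero⟩
  haveI : Finite (Rk k) := S.finite_coeffLevel hy k
  haveI : Module.Free (Rk k) (N k) := (hy.h0 k).1
  haveI : Module.Finite (Rk k) (N k) := Module.finite_of_finrank_eq_succ (hy.h0 k).2
  have hRk : ∀ r : Rk k, p ^ k' • r = 0 := S.natCast_pow_smul_levelRing_eq_zero hy k hk'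
  obtain ⟨lam, hbij⟩ := S.exists_frobeniusCharacter_levelRing hy k hk'
  exact ⟨lam, apply_algebraMap_mul_eq_toZModPow_mul hRk lam, hbij,
    Dbar.toTateDual_bijective lam _ exp hexp hexpb
      (bijective_comp_linearMap_of_surjective (M := N k) lam hbij (S.πbar k) (hy.h1 k).1.surjective)⟩

/-- **The `H²`-detection binder `hdet` of the Frobenius-form reading files, at EVERY place, for any duality datum over the
level ring `R_k`** (`p^{k'} ∈ 𝔪^{e_k}`, `exp` bijective, `λ` a Frobenius character of `R_k`): a class
`z ∈ H²(K_v, R_k(1))` with `H²(exp ∘ λ_b) z = 0` for all `b ∈ R_k` vanishes — finite places by local Tate duality in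
bidegree `(2,0)` (`eq_zero_of_forall_cohomologyMap_expLam_eq_zero_of_finite`: every semilinear `λ'` is a `λ_b`), infinite
places because `H²(K_w, ·)` of an odd-torsion module is `0`.
[cite: Howard2004HeegnerKolyvagin, §1.3 H.4 (arXiv:1202.6340 p. 7 L78–82)] [cite: SerreGaloisCohomology1997, II §5.2 Thm. 2] -/
theorem residual_hdet (S : DVRSetting p K R N Rk Nbar Nq) (hy : S.SatisfiesH) (k : ℕ) {k' : ℕ}
    (hk' : ((p : ℕ) : R) ^ k' ∈ IsLocalRing.maximalIdeal R ^ S.e k)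
    (exp : ZMod (p ^ k') →+ MuCarrier K (p ^ k'))
    (hexp : ∀ (g : absoluteGaloisGroup K) (x : ZMod (p ^ k')),
      exp (cyclotomicCharacterModPow K p k' g * x) = mu K (p ^ k') g (exp x))
    (hexpb : Bijective exp) {M' : Type} [AddCommGroup M'] [TopologicalSpace M'] [DiscreteTopology M']
    [Module (Rk k) M'] {ρ' : DiscreteGaloisModule K M'} (D' : DualityDatum p S.cd ρ' (Rk k))
    (lam : Rk k →+ ZMod (p ^ k'))
    (hlam : ∀ (z : ℤ_[p]) (a : Rk k), lam (algebraMap ℤ_[p] (Rk k) z * a) = PadicInt.toZModPow k' z * lam a)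
    (hfrob : Bijective ((AddMonoidHom.mul : Rk k →+ Rk k →+ Rk k).compr₂ lam)) :
    ∀ (v : Place K) (z : galoisCohomology (D'.twistOne.toLocal v) 2),
      (∀ b : Rk k, cohomologyMap (D'.expLamLocalHom (DualityDatum.lamMul lam b)
        (DualityDatum.lamMul_semilinear lam hlam b) exp hexp v) 2 z = 0) → z = 0 := by
  haveI : NeZero (p ^ k') := ⟨pow_ne_zero _ (Fact.out : p.Prime).ne_zero⟩
  haveI : Finite (Rk k) := S.finite_coeffLevel hy k
  have hp : p.Prime := Fact.out
  have hRk : ∀ r : Rk k, p ^ k' • r = 0 := S.natCast_pow_smul_levelRing_eq_zero hy k hk'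
  have hodd : Odd (p ^ k') := (hp.odd_of_ne_two hy.p_odd).pow
  intro v z hz
  rcases v with w | v
  · exact galoisCohomology_two_toLocal_inl_eq_zero_of_odd D'.twistOne w hodd hRk z
  · refine D'.eq_zero_of_forall_cohomologyMap_expLam_eq_zero_of_finite exp hexp hRk hexpb v z ?_
    intro lam' hlam'
    obtain ⟨b, hb⟩ := hfrob.2 lam'
    subst hb
    exact hz b

end DVRSetting

end Literature.NumberTheory.GaloisCohomology.Howard2004

end
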